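import Summits.HodgeConjecture.CorCM.CyclicAsymmetricCMHalves
import Summits.HodgeConjecture.CorCM.AbelianTwoGroupInvolutionLemmas
import HarnessLib

/-!
# Asymmetric aperiodic CM halves of `ℤ/2n × ℤ/2` for the involutions `h = (n, 1)` and `h = (0, 1)` (`n ≥ 4`)

COR-CM (cell `pub-hodgecm2`), binder seat b04 (gen 22), count-neutral claim GALOIS-DIHEDRAL, part VI-b — companion of
part VI-a (`CorCM/CyclicAsymmetricCMHalvesTimesTwo`, the involution `h = (n, 0)`): the halves needed by the mirror types
of part V for the OTHER two central involutions `(rⁿ, z)`, `(1, z)` of the Galois groups `D_{2n} × C₂`.  KERNEL ONLY: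
theorems; no definition, no named fact, no `sorry`.  `HC_CM` is neither used nor claimed.

`A = ℤ/2n × ℤ/2`.  For `h ∈ A` of order `2`, a CM HALF is `S ⊆ A` with `p ∈ S ⟺ h + p ∉ S`; aperiodic: `j + S ≠ S` for
`j ≠ 0`; asymmetric: `u − S ≠ S` for all `u`.  Seat census (`scratch-g22/g22n.py`): for `h = (n, 1)` and for `h = (0, 1)`
such halves exist iff `n ≥ 4` (counts `0, 0, 0, 64, 480, 2736` for `n = 1..6`, both cases).  Explicit families (row `0`
is `X = [0, n) ∪ {n + 1}` in both):
* `h = (n, 1)` (§2): `S = (X × {0}) ∪ (([0, n) ∖ {1}) × {1})`, i.e.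
  `(k, z) ∈ S ⟺ (z = 0 ∧ (k < n ∨ k = n + 1)) ∨ (z = 1 ∧ k < n ∧ k ≠ 1)`;
* `h = (0, 1)` (§3): `S = (X × {0}) ∪ (Xᶜ × {1})`, i.e.
  `(k, z) ∈ S ⟺ (z = 0 ∧ (k < n ∨ k = n + 1)) ∨ (z = 1 ∧ (k = n ∨ n + 2 ≤ k))`
(residues `k` read in `[0, 2n)`).  For each: existence, CM property, `aperiodic`, `asymmetric` (`n ≥ 4`; a couple of
probe points pin the period / axis through the interval-like row `0`, the displaced points break it; `omega`).

## References

* [Shimura1998] G. Shimura, *Abelian Varieties with Complex Multiplication and Modular Functions*, §8.2 Prop. 26.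
-/

namespace Summit.HodgeConjecture.CorCM.CyclicAsymmetricHalvesTimesTwo

open Summit.HodgeConjecture.CorCM.CyclicAsymmetricHalves
open Summit.HodgeConjecture.CorCM.TwoGroupPieces (zmod_two_cases)

variable {n : ℕ} [NeZero n] {S : Finset (ZMod (2 * n) × ZMod 2)}

/-! ## §2 The half for `h = (n, 1)` -/

section Mixed

/-- **The explicit half for `h = (n, 1)` exists.** [folklore] -/
theorem exists_halfB (n : ℕ) [NeZero n] : ∃ S : Finset (ZMod (2 * n) × ZMod 2), ∀ p : ZMod (2 * n) × ZMod 2,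
    p ∈ S ↔ (p.2 = 0 ∧ (p.1.val < n ∨ p.1.val = n + 1)) ∨ (p.2 = 1 ∧ p.1.val < n ∧ p.1.val ≠ 1) :=
  ⟨Finset.univ.filter fun p => (p.2 = 0 ∧ (p.1.val < n ∨ p.1.val = n + 1)) ∨ (p.2 = 1 ∧ p.1.val < n ∧ p.1.val ≠ 1),
    fun p => by simp⟩

omit [NeZero n] in
/-- Membership of `(k, 0)`. [folklore] -/
theorem halfB_mk_zero_mem_iff
    (hS : ∀ p : ZMod (2 * n) × ZMod 2,
      p ∈ S ↔ (p.2 = 0 ∧ (p.1.val < n ∨ p.1.val = n + 1)) ∨ (p.2 = 1 ∧ p.1.val < n ∧ p.1.val ≠ 1))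
    (k : ZMod (2 * n)) : (k, (0 : ZMod 2)) ∈ S ↔ k.val < n ∨ k.val = n + 1 := by
  rw [hS]; simp

omit [NeZero n] in
/-- Membership of `(k, 1)`. [folklore] -/
theorem halfB_mk_one_mem_iff
    (hS : ∀ p : ZMod (2 * n) × ZMod 2,
      p ∈ S ↔ (p.2 = 0 ∧ (p.1.val < n ∨ p.1.val = n + 1)) ∨ (p.2 = 1 ∧ p.1.val < n ∧ p.1.val ≠ 1))
    (k : ZMod (2 * n)) : (k, (1 : ZMod 2)) ∈ S ↔ k.val < n ∧ k.val ≠ 1 := by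
  rw [hS]; simp

omit [NeZero n] in
/-- Membership of `((c : ℕ), 0)`, `c < 2n`. [folklore] -/
theorem halfB_natCast_zero_mem_iff
    (hS : ∀ p : ZMod (2 * n) × ZMod 2,
      p ∈ S ↔ (p.2 = 0 ∧ (p.1.val < n ∨ p.1.val = n + 1)) ∨ (p.2 = 1 ∧ p.1.val < n ∧ p.1.val ≠ 1))
    {c : ℕ} (hc : c < 2 * n) : ((c : ZMod (2 * n)), (0 : ZMod 2)) ∈ S ↔ c < n ∨ c = n + 1 := by
  rw [halfB_mk_zero_mem_iff hS, val_natCast_of_lt' hc]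

omit [NeZero n] in
/-- Membership of `((c : ℕ), 1)`, `c < 2n`. [folklore] -/
theorem halfB_natCast_one_mem_iff
    (hS : ∀ p : ZMod (2 * n) × ZMod 2,
      p ∈ S ↔ (p.2 = 0 ∧ (p.1.val < n ∨ p.1.val = n + 1)) ∨ (p.2 = 1 ∧ p.1.val < n ∧ p.1.val ≠ 1))
    {c : ℕ} (hc : c < 2 * n) : ((c : ZMod (2 * n)), (1 : ZMod 2)) ∈ S ↔ c < n ∧ c ≠ 1 := by
  rw [halfB_mk_one_mem_iff hS, val_natCast_of_lt' hc]

/-- **CM half for `h = (n, 1)`**: `p ∈ S ↔ (n, 1) + p ∉ S` (`n ≥ 2`). [cite: Shimura1998, §8.2 Prop. 26] -/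
theorem halfB_mem_iff_add_not_mem (h2 : 2 ≤ n)
    (hS : ∀ p : ZMod (2 * n) × ZMod 2,
      p ∈ S ↔ (p.2 = 0 ∧ (p.1.val < n ∨ p.1.val = n + 1)) ∨ (p.2 = 1 ∧ p.1.val < n ∧ p.1.val ≠ 1))
    (p : ZMod (2 * n) × ZMod 2) : p ∈ S ↔ (((n : ℕ) : ZMod (2 * n)), (1 : ZMod 2)) + p ∉ S := by
  obtain ⟨k, z⟩ := p
  have hk := k.val_lt
  have hval : ((n : ZMod (2 * n)) + k).val = if k.val < n then k.val + n else k.val - n := by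
    rw [add_comm, val_add_natCast_eq k (show n < 2 * n by omega)]
    split_ifs <;> omega
  rcases zmod_two_cases z with rfl | rfl
  · rw [Prod.mk_add_mk, add_zero, halfB_mk_zero_mem_iff hS, halfB_mk_one_mem_iff hS, hval]
    split_ifs <;> omega
  · rw [Prod.mk_add_mk, show (1 : ZMod 2) + 1 = 0 by decide, halfB_mk_one_mem_iff hS, halfB_mk_zero_mem_iff hS,
      hval]
    split_ifs <;> omega

/-- **The half for `h = (n, 1)` is APERIODIC** (`n ≥ 3`). [cite: Shimura1998, §8.2 Prop. 26] -/
theorem halfB_aperiodic (h3 : 3 ≤ n)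
    (hS : ∀ p : ZMod (2 * n) × ZMod 2,
      p ∈ S ↔ (p.2 = 0 ∧ (p.1.val < n ∨ p.1.val = n + 1)) ∨ (p.2 = 1 ∧ p.1.val < n ∧ p.1.val ≠ 1))
    {j : ZMod (2 * n) × ZMod 2} (hj : j ≠ 0) : ∃ k, ¬ (k ∈ S ↔ j + k ∈ S) := by
  by_contra hall
  push Not at hall
  obtain ⟨j₁, j₂⟩ := j
  have hb := j₁.val_lt
  rcases zmod_two_cases j₂ with rfl | rfl
  · have hj₁ : j₁.val ≠ 0 := fun h => hj (by rw [(ZMod.val_eq_zero j₁).1 h]; rfl)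
    have hA := (hall (((0 : ℕ) : ZMod (2 * n)), 1)).1
      ((halfB_natCast_one_mem_iff hS (by omega)).2 ⟨by omega, by omega⟩)
    rw [Prod.mk_add_mk, Nat.cast_zero, add_zero, zero_add, halfB_mk_one_mem_iff hS] at hA
    have hB := (hall (((n - 1 : ℕ) : ZMod (2 * n)), 1)).1
      ((halfB_natCast_one_mem_iff hS (by omega)).2 ⟨by omega, by omega⟩)
    rw [Prod.mk_add_mk, zero_add, halfB_mk_one_mem_iff hS,
      val_add_natCast_eq j₁ (show n - 1 < 2 * n by omega)] at hB
    split_ifs at hB <;> omega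
  · have hA := (hall (((1 : ℕ) : ZMod (2 * n)), 0)).1 ((halfB_natCast_zero_mem_iff hS (by omega)).2 (by omega))
    rw [Prod.mk_add_mk, add_zero, halfB_mk_one_mem_iff hS, val_add_natCast_eq j₁ (show 1 < 2 * n by omega)] at hA
    have hB : ¬ ((j₁ + ((1 : ℕ) : ZMod (2 * n)), (1 : ZMod 2) + 1) ∈ S) := fun h =>
      absurd ((hall (((1 : ℕ) : ZMod (2 * n)), 1)).2 (by rwa [Prod.mk_add_mk]))
        (by rw [halfB_natCast_one_mem_iff hS (by omega)]; omega)
    rw [show (1 : ZMod 2) + 1 = 0 by decide, halfB_mk_zero_mem_iff hS,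
      val_add_natCast_eq j₁ (show 1 < 2 * n by omega)] at hB
    split_ifs at hA hB <;> omega

/-- **The half for `h = (n, 1)` is ASYMMETRIC** (`n ≥ 4`). [cite: Shimura1998, §8.2 Prop. 26] -/
theorem halfB_asymmetric (h4 : 4 ≤ n)
    (hS : ∀ p : ZMod (2 * n) × ZMod 2,
      p ∈ S ↔ (p.2 = 0 ∧ (p.1.val < n ∨ p.1.val = n + 1)) ∨ (p.2 = 1 ∧ p.1.val < n ∧ p.1.val ≠ 1))
    (u : ZMod (2 * n) × ZMod 2) : ∃ k, ¬ (k ∈ S ↔ u - k ∈ S) := by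
  by_contra hall
  push Not at hall
  obtain ⟨u₁, u₂⟩ := u
  have ha := u₁.val_lt
  rcases zmod_two_cases u₂ with rfl | rfl
  · have hA := (hall (((0 : ℕ) : ZMod (2 * n)), 1)).1
      ((halfB_natCast_one_mem_iff hS (by omega)).2 ⟨by omega, by omega⟩)
    rw [Prod.mk_sub_mk, Nat.cast_zero, sub_zero, show (0 : ZMod 2) - 1 = 1 by decide,
      halfB_mk_one_mem_iff hS] at hA
    have hB : ¬ ((u₁ - ((1 : ℕ) : ZMod (2 * n)), (0 : ZMod 2) - 1) ∈ S) := fun h =>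
      absurd ((hall (((1 : ℕ) : ZMod (2 * n)), 1)).2 (by rwa [Prod.mk_sub_mk]))
        (by rw [halfB_natCast_one_mem_iff hS (by omega)]; omega)
    rw [show (0 : ZMod 2) - 1 = 1 by decide, halfB_mk_one_mem_iff hS,
      val_sub_natCast_eq u₁ (show 1 < 2 * n by omega)] at hB
    have hC := (hall (((3 : ℕ) : ZMod (2 * n)), 1)).1
      ((halfB_natCast_one_mem_iff hS (by omega)).2 ⟨by omega, by omega⟩)
    rw [Prod.mk_sub_mk, show (0 : ZMod 2) - 1 = 1 by decide, halfB_mk_one_mem_iff hS,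
      val_sub_natCast_eq u₁ (show 3 < 2 * n by omega)] at hC
    split_ifs at hB hC <;> omega
  · have hA := (hall (((1 : ℕ) : ZMod (2 * n)), 0)).1 ((halfB_natCast_zero_mem_iff hS (by omega)).2 (by omega))
    rw [Prod.mk_sub_mk, sub_zero, halfB_mk_one_mem_iff hS, val_sub_natCast_eq u₁ (show 1 < 2 * n by omega)] at hA
    have hB : ¬ ((u₁ - ((1 : ℕ) : ZMod (2 * n)), (1 : ZMod 2) - 1) ∈ S) := fun h =>
      absurd ((hall (((1 : ℕ) : ZMod (2 * n)), 1)).2 (by rwa [Prod.mk_sub_mk]))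
        (by rw [halfB_natCast_one_mem_iff hS (by omega)]; omega)
    rw [sub_self, halfB_mk_zero_mem_iff hS, val_sub_natCast_eq u₁ (show 1 < 2 * n by omega)] at hB
    split_ifs at hA hB <;> omega

end Mixed

/-! ## §3 The half for `h = (0, 1)` -/

section Vertical

/-- **The explicit half for `h = (0, 1)` exists.** [folklore] -/
theorem exists_halfC (n : ℕ) [NeZero n] : ∃ S : Finset (ZMod (2 * n) × ZMod 2), ∀ p : ZMod (2 * n) × ZMod 2,
    p ∈ S ↔ (p.2 = 0 ∧ (p.1.val < n ∨ p.1.val = n + 1)) ∨ (p.2 = 1 ∧ (p.1.val = n ∨ n + 2 ≤ p.1.val)) :=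
  ⟨Finset.univ.filter fun p => (p.2 = 0 ∧ (p.1.val < n ∨ p.1.val = n + 1)) ∨ (p.2 = 1 ∧ (p.1.val = n ∨ n + 2 ≤ p.1.val)),
    fun p => by simp⟩

omit [NeZero n] in
/-- Membership of `(k, 0)`. [folklore] -/
theorem halfC_mk_zero_mem_iff
    (hS : ∀ p : ZMod (2 * n) × ZMod 2,
      p ∈ S ↔ (p.2 = 0 ∧ (p.1.val < n ∨ p.1.val = n + 1)) ∨ (p.2 = 1 ∧ (p.1.val = n ∨ n + 2 ≤ p.1.val)))
    (k : ZMod (2 * n)) : (k, (0 : ZMod 2)) ∈ S ↔ k.val < n ∨ k.val = n + 1 := by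
  rw [hS]; simp

omit [NeZero n] in
/-- Membership of `(k, 1)`. [folklore] -/
theorem halfC_mk_one_mem_iff
    (hS : ∀ p : ZMod (2 * n) × ZMod 2,
      p ∈ S ↔ (p.2 = 0 ∧ (p.1.val < n ∨ p.1.val = n + 1)) ∨ (p.2 = 1 ∧ (p.1.val = n ∨ n + 2 ≤ p.1.val)))
    (k : ZMod (2 * n)) : (k, (1 : ZMod 2)) ∈ S ↔ k.val = n ∨ n + 2 ≤ k.val := by
  rw [hS]; simp

omit [NeZero n] in
/-- Membership of `((c : ℕ), 0)`, `c < 2n`. [folklore] -/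
theorem halfC_natCast_zero_mem_iff
    (hS : ∀ p : ZMod (2 * n) × ZMod 2,
      p ∈ S ↔ (p.2 = 0 ∧ (p.1.val < n ∨ p.1.val = n + 1)) ∨ (p.2 = 1 ∧ (p.1.val = n ∨ n + 2 ≤ p.1.val)))
    {c : ℕ} (hc : c < 2 * n) : ((c : ZMod (2 * n)), (0 : ZMod 2)) ∈ S ↔ c < n ∨ c = n + 1 := by
  rw [halfC_mk_zero_mem_iff hS, val_natCast_of_lt' hc]

/-- **CM half for `h = (0, 1)`**: `p ∈ S ↔ (0, 1) + p ∉ S`. [cite: Shimura1998, §8.2 Prop. 26] -/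
theorem halfC_mem_iff_add_not_mem
    (hS : ∀ p : ZMod (2 * n) × ZMod 2,
      p ∈ S ↔ (p.2 = 0 ∧ (p.1.val < n ∨ p.1.val = n + 1)) ∨ (p.2 = 1 ∧ (p.1.val = n ∨ n + 2 ≤ p.1.val)))
    (p : ZMod (2 * n) × ZMod 2) : p ∈ S ↔ ((0 : ZMod (2 * n)), (1 : ZMod 2)) + p ∉ S := by
  obtain ⟨k, z⟩ := p
  have hk := k.val_lt
  rcases zmod_two_cases z with rfl | rfl
  · rw [Prod.mk_add_mk, zero_add, add_zero, halfC_mk_zero_mem_iff hS, halfC_mk_one_mem_iff hS]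
    omega
  · rw [Prod.mk_add_mk, zero_add, show (1 : ZMod 2) + 1 = 0 by decide, halfC_mk_one_mem_iff hS,
      halfC_mk_zero_mem_iff hS]
    omega

/-- **The half for `h = (0, 1)` is APERIODIC** (`n ≥ 3`). [cite: Shimura1998, §8.2 Prop. 26] -/
theorem halfC_aperiodic (h3 : 3 ≤ n)
    (hS : ∀ p : ZMod (2 * n) × ZMod 2,
      p ∈ S ↔ (p.2 = 0 ∧ (p.1.val < n ∨ p.1.val = n + 1)) ∨ (p.2 = 1 ∧ (p.1.val = n ∨ n + 2 ≤ p.1.val)))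
    {j : ZMod (2 * n) × ZMod 2} (hj : j ≠ 0) : ∃ k, ¬ (k ∈ S ↔ j + k ∈ S) := by
  by_contra hall
  push Not at hall
  obtain ⟨j₁, j₂⟩ := j
  have hb := j₁.val_lt
  rcases zmod_two_cases j₂ with rfl | rfl
  · have hj₁ : j₁.val ≠ 0 := fun h => hj (by rw [(ZMod.val_eq_zero j₁).1 h]; rfl)
    have hA := (hall (((0 : ℕ) : ZMod (2 * n)), 0)).1 ((halfC_natCast_zero_mem_iff hS (by omega)).2 (by omega))
    rw [Prod.mk_add_mk, Nat.cast_zero, add_zero, add_zero, halfC_mk_zero_mem_iff hS] at hA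
    have hB := (hall (((1 : ℕ) : ZMod (2 * n)), 0)).1 ((halfC_natCast_zero_mem_iff hS (by omega)).2 (by omega))
    rw [Prod.mk_add_mk, add_zero, halfC_mk_zero_mem_iff hS, val_add_natCast_eq j₁ (show 1 < 2 * n by omega)] at hB
    have hC := (hall (((n + 1 : ℕ) : ZMod (2 * n)), 0)).1 ((halfC_natCast_zero_mem_iff hS (by omega)).2 (by omega))
    rw [Prod.mk_add_mk, add_zero, halfC_mk_zero_mem_iff hS,
      val_add_natCast_eq j₁ (show n + 1 < 2 * n by omega)] at hC
    split_ifs at hB hC <;> omega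
  · have hA := (hall (((1 : ℕ) : ZMod (2 * n)), 0)).1 ((halfC_natCast_zero_mem_iff hS (by omega)).2 (by omega))
    rw [Prod.mk_add_mk, add_zero, halfC_mk_one_mem_iff hS, val_add_natCast_eq j₁ (show 1 < 2 * n by omega)] at hA
    have hB := (hall (((n + 1 : ℕ) : ZMod (2 * n)), 0)).1 ((halfC_natCast_zero_mem_iff hS (by omega)).2 (by omega))
    rw [Prod.mk_add_mk, add_zero, halfC_mk_one_mem_iff hS,
      val_add_natCast_eq j₁ (show n + 1 < 2 * n by omega)] at hB
    split_ifs at hA hB <;> omega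

/-- **The half for `h = (0, 1)` is ASYMMETRIC** (`n ≥ 4`). [cite: Shimura1998, §8.2 Prop. 26] -/
theorem halfC_asymmetric (h4 : 4 ≤ n)
    (hS : ∀ p : ZMod (2 * n) × ZMod 2,
      p ∈ S ↔ (p.2 = 0 ∧ (p.1.val < n ∨ p.1.val = n + 1)) ∨ (p.2 = 1 ∧ (p.1.val = n ∨ n + 2 ≤ p.1.val)))
    (u : ZMod (2 * n) × ZMod 2) : ∃ k, ¬ (k ∈ S ↔ u - k ∈ S) := by
  by_contra hall
  push Not at hall
  obtain ⟨u₁, u₂⟩ := u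
  have ha := u₁.val_lt
  rcases zmod_two_cases u₂ with rfl | rfl
  · have hA := (hall (((0 : ℕ) : ZMod (2 * n)), 0)).1 ((halfC_natCast_zero_mem_iff hS (by omega)).2 (by omega))
    rw [Prod.mk_sub_mk, Nat.cast_zero, sub_zero, sub_zero, halfC_mk_zero_mem_iff hS] at hA
    have hB := (hall (((1 : ℕ) : ZMod (2 * n)), 0)).1 ((halfC_natCast_zero_mem_iff hS (by omega)).2 (by omega))
    rw [Prod.mk_sub_mk, sub_zero, halfC_mk_zero_mem_iff hS, val_sub_natCast_eq u₁ (show 1 < 2 * n by omega)] at hB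
    have hC := (hall (((3 : ℕ) : ZMod (2 * n)), 0)).1 ((halfC_natCast_zero_mem_iff hS (by omega)).2 (by omega))
    rw [Prod.mk_sub_mk, sub_zero, halfC_mk_zero_mem_iff hS, val_sub_natCast_eq u₁ (show 3 < 2 * n by omega)] at hC
    have hD := (hall (((n + 1 : ℕ) : ZMod (2 * n)), 0)).1 ((halfC_natCast_zero_mem_iff hS (by omega)).2 (by omega))
    rw [Prod.mk_sub_mk, sub_zero, halfC_mk_zero_mem_iff hS,
      val_sub_natCast_eq u₁ (show n + 1 < 2 * n by omega)] at hD
    split_ifs at hB hC hD <;> omega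
  · have hA := (hall (((1 : ℕ) : ZMod (2 * n)), 0)).1 ((halfC_natCast_zero_mem_iff hS (by omega)).2 (by omega))
    rw [Prod.mk_sub_mk, sub_zero, halfC_mk_one_mem_iff hS, val_sub_natCast_eq u₁ (show 1 < 2 * n by omega)] at hA
    have hB := (hall (((n + 1 : ℕ) : ZMod (2 * n)), 0)).1 ((halfC_natCast_zero_mem_iff hS (by omega)).2 (by omega))
    rw [Prod.mk_sub_mk, sub_zero, halfC_mk_one_mem_iff hS,
      val_sub_natCast_eq u₁ (show n + 1 < 2 * n by omega)] at hB
    split_ifs at hA hB <;> omega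

end Vertical

end Summit.HodgeConjecture.CorCM.CyclicAsymmetricHalvesTimesTwo
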